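import Summits.Langlands.Langlands.Theses.AbelianSurfaceSerre
import Summits.Langlands.Langlands.Theorems.AbelianSurfaceSerreSurfaceSectorComplementRigidityTransportLAlg
import Summits.Langlands.Langlands.Theorems.DyadicOddResidueSectorComplementJunctionOfFacts
import Literature.NumberTheory.Automorphic.LocalLanglandsGLIndecomposable
import Literature.NumberTheory.GaloisRepresentations.HenniartGaloisSideCharacterisation
import HarnessLib

/-!
# Route AbelianSurfaceSerre — `SurfaceSectorComplement` (stmt-Langlands-17767): the frame modulo the NAMED
FACTS of print, and its sandwich by the item `ReciprocityUpToIrreducibilityR` (stmt-Langlands-17925) —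
item-level certificate of the cycle-7 reshape of line `Sketch` (lead prover-line-stmt-Langlands-17767-c6-0;
`--supports` file: no `sorry`, no definition)

`SurfaceSectorComplement := EndTrivialSurfacesModular → _root_.Langlands` (`X := EndTrivialSurfacesModular`,
the sector: a.e.-Satake modularity of the abelian surfaces `A/ℚ` with `End_ℚ A = ℤ`) is the route's frame item
("the rest of the summit").  Line `Sketch` reduces it to Rʷ ∧ junction: Rʷ = rigidity of PINNED reciprocity
data on the local components of the L-algebraic cuspidal `π` (registered stub S1ʷ of cycles 2–6), junction =
`X → Langlands_∃` (stubs S2a–S2c = `X →` item 1093, items 1094, 1095 of route `BaseFieldAscent`); TIGHT: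
`surfaceSectorComplement_iff_rigidity_and_junction : C ↔ (X → Rʷ) ∧ (X → Langlands_∃)` (p157164).

Cycle 7: the unrestricted rigidity R has LANDED modulo the three named local facts of print
(`recRigidityOnLocalComponents_of_namedFacts`, line `Sketch_18745_r1_k1` of the twin frame stmt-Langlands-18745:
(F1) `localLanglands_gl` — Harris–Taylor 2001 Thm A, Henniart 1993 Thm 1.1; (F2)
`localLanglands_gl_indecomposable` — Henniart 2002 Thm 1.5 (i), Zelevinsky 1980 Thm 9.7; (F3)
`Henniart2002_isEquivalent_of_rootMultiplicity_eulerFactor_tprod_eq` — Henniart 2002 Thm 1.7 (a)).  This module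
records, kernel-checked, where THIS frame's open content lives after the reshape:

* `recRigidityLAlg_of_namedFacts` — Rʷ (the text of the former stub S1ʷ, verbatim) from F1–F3;
* `surfaceSectorComplement_iff_junctionExists_of_namedFacts` — granted F1–F3, `C ↔ (X → Langlands_∃)`: the
  frame's whole `∀ 𝓡` debt is printed local mathematics, and the line closes the crux EXACTLY when its
  junction stubs S2a–S2c do (`surfaceSectorComplement_of_junctionExists_of_namedFacts` is the `←` half by name);
* `surfaceSectorComplement_of_reciprocityUpToIrreducibilityR_text_of_JS`,
  `reciprocityUpToIrreducibilityR_text_of_surfaceSectorComplement`,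
  `surfaceSectorComplement_iff_reciprocityUpToIrreducibilityR_text` — the SANDWICH by existing items, as for
  the twin frame: the texts of stmt-Langlands-17925 (reciprocity up to irreducibility for every pinned datum,
  with the non-vacuity conjunct), stmt-Langlands-13622 `AnalyticDescent.PairLBoundaryJS` and stmt-Langlands-19093
  `AnalyticDescent.PairLPoleJS` give the crux with the sector X IDLE (a frame item cannot consume its sector
  non-vacuously); conversely the crux and X give the text of 17925.  So under X and JS this crux, too, IS item
  17925 — an alternative junction to 1093 ∘ 1094 ∘ 1095, recorded for the planners; nothing is claimed.

References: G. Henniart, Invent. Math. 113 (1993), Thm. 1.1 [Henniarts1993]; G. Henniart, Bull. SMF 130 (2002),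
Thm. 1.5, Thm. 1.7 (a) [HenniartBSMF2002]; M. Harris, R. Taylor, Ann. Math. Stud. 151 (2001), Thm. A
[HarrisTaylorAMS2001]; K. Buzzard, T. Gee, LMS LNS 414 (2014), Conj. 3.2.1–3.2.2 [BuzzardGeeLMS2014];
J. Arthur, L. Clozel, Ann. Math. Stud. 120, Ch. 3 §2 (2.2)–(2.3) [ArthurClozelAMS120].
-/

noncomputable section

set_option linter.dupNamespace false -- project-wide option; `Summit.Langlands.Langlands` is the mandated namespace

open scoped MatrixGroups NumberField
open NumberField IsDedekindDomain Filter MeasureTheory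
open Literature.NumberTheory.Automorphic Literature.NumberTheory.GaloisRepresentations
open Summit.Langlands
open Summit.Langlands.Langlands.Theses
open Summit.Langlands.Langlands.Theses.AbelianSurfaceSerre

namespace Summit.Langlands.Langlands.Theorems.ReciprocityRigidity

/-! ## §1 Rʷ and the frame modulo the three named facts of print -/

/-- **Rʷ from the named facts (F1) `localLanglands_gl`, (F2) `localLanglands_gl_indecomposable`, (F3)
`Henniart2002_isEquivalent_of_rootMultiplicity_eulerFactor_tprod_eq`** — the text of line `Sketch`'s former
stub S1ʷ `stub_recRigidityLAlg`, verbatim: any two pinned reciprocity data of a number field agree on the local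
components of the L-algebraic cuspidal automorphic representations of `GL_n`, `n ≥ 1` (the unrestricted
rigidity of line 18745, restricted by `rigid_lAlgebraic_of_rigid`).
[cite: Henniarts1993, Thm 1.1] [cite: HenniartBSMF2002, Thm. 1.5 and Thm. 1.7 (a)] -/
theorem recRigidityLAlg_of_namedFacts
    (hF1 : ∀ (F : Type) [Field F] [ValuativeRel F] [TopologicalSpace F] [IsNonarchimedeanLocalField F]
      (hmul : @IsFrobPow.mul F _ _ _ _) (huniq : @IsFrobPow.unique F _ _ _ _)
      (hn : absInertia_normal F) (hex : @exists_isFrobPow F _ _ _ _)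
      (hns : @WeilGroup.exists_subgroup_le_inertia_isOpen_of_continuous F _ _ _ _)
      (d : LocalArtinData F) (𝓔 : LocalEpsilonSystem F) (hd : 𝓔.artin F = d),
      localLanglands_gl F hmul huniq hn hex hns d 𝓔 hd)
    (hF2 : ∀ (F : Type) [Field F] [ValuativeRel F] [TopologicalSpace F] [IsNonarchimedeanLocalField F]
      (hmul : @IsFrobPow.mul F _ _ _ _) (huniq : @IsFrobPow.unique F _ _ _ _)
      (hn : absInertia_normal F) (hex : @exists_isFrobPow F _ _ _ _)
      (hns : @WeilGroup.exists_subgroup_le_inertia_isOpen_of_continuous F _ _ _ _)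
      (d : LocalArtinData F) (𝓔 : LocalEpsilonSystem F) (hd : 𝓔.artin F = d),
      localLanglands_gl_indecomposable F hmul huniq hn hex hns d 𝓔 hd)
    (hF3 : ∀ (F : Type) [Field F] [ValuativeRel F] [TopologicalSpace F] [IsNonarchimedeanLocalField F],
      Henniart2002_isEquivalent_of_rootMultiplicity_eulerFactor_tprod_eq F) :
    ∀ (K : Type) [Field K] [NumberField K] (𝓡 𝓡' : ReciprocityData K) (n : ℕ)
      (hcpt : isCompact_glFiniteIntegralLevel n K), 0 < n →
      ∀ π : CuspidalAutomorphicRepData n K hcpt, π.1.IsLAlgebraic →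
        ∀ (v : HeightOneSpectrum (𝓞 K)) (πv : SmoothIrrep (GL (Fin n) (v.adicCompletion K))),
          π.1.HasLocalComponentAt v πv.ρ →
            (𝓡.llc v).recGL n (IrrClass.mk πv) = (𝓡'.llc v).recGL n (IrrClass.mk πv) :=
  rigid_lAlgebraic_of_rigid (recRigidityOnLocalComponents_of_namedFacts hF1 hF2 hF3)

/-- **Granted the three named local facts, the frame follows from its junction** `X → Langlands_∃` (the
`←` half of the certificate below, by name: the transport `langlands_iff_exists_of_rigid_lAlgebraic` along
data rigid on L-algebraic cuspidal `π`). [cite: Henniarts1993, Thm 1.1]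
[cite: HenniartBSMF2002, Thm. 1.5 and Thm. 1.7 (a)] -/
theorem surfaceSectorComplement_of_junctionExists_of_namedFacts
    (hF1 : ∀ (F : Type) [Field F] [ValuativeRel F] [TopologicalSpace F] [IsNonarchimedeanLocalField F]
      (hmul : @IsFrobPow.mul F _ _ _ _) (huniq : @IsFrobPow.unique F _ _ _ _)
      (hn : absInertia_normal F) (hex : @exists_isFrobPow F _ _ _ _)
      (hns : @WeilGroup.exists_subgroup_le_inertia_isOpen_of_continuous F _ _ _ _)
      (d : LocalArtinData F) (𝓔 : LocalEpsilonSystem F) (hd : 𝓔.artin F = d),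
      localLanglands_gl F hmul huniq hn hex hns d 𝓔 hd)
    (hF2 : ∀ (F : Type) [Field F] [ValuativeRel F] [TopologicalSpace F] [IsNonarchimedeanLocalField F]
      (hmul : @IsFrobPow.mul F _ _ _ _) (huniq : @IsFrobPow.unique F _ _ _ _)
      (hn : absInertia_normal F) (hex : @exists_isFrobPow F _ _ _ _)
      (hns : @WeilGroup.exists_subgroup_le_inertia_isOpen_of_continuous F _ _ _ _)
      (d : LocalArtinData F) (𝓔 : LocalEpsilonSystem F) (hd : 𝓔.artin F = d),
      localLanglands_gl_indecomposable F hmul huniq hn hex hns d 𝓔 hd)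
    (hF3 : ∀ (F : Type) [Field F] [ValuativeRel F] [TopologicalSpace F] [IsNonarchimedeanLocalField F],
      Henniart2002_isEquivalent_of_rootMultiplicity_eulerFactor_tprod_eq F)
    (hJ : EndTrivialSurfacesModular →
      ∀ (F : Type) [Field F] [NumberField F], ∃ 𝓡 : ReciprocityData F, ∀ n : ℕ, 0 < n →
        ∀ hcpt : isCompact_glFiniteIntegralLevel n F, GlobalLanglandsCorrespondenceGLn n F 𝓡 hcpt) :
    SurfaceSectorComplement :=
  fun hX => (langlands_iff_exists_of_rigid_lAlgebraic (recRigidityLAlg_of_namedFacts hF1 hF2 hF3)).2 (hJ hX)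

/-- **The line certificate after the cycle-7 reshape: granted the three named local facts, the frame is
EQUIVALENT to its junction** `X → Langlands_∃`: `→` is free (a datum from the summit's `Nonempty` conjunct,
the clause from its `∀ 𝓡` conjunct), `←` is `surfaceSectorComplement_of_junctionExists_of_namedFacts`.  With
`surfaceSectorComplement_iff_rigidity_and_junction` (p157164) this says: the frame's entire `∀ 𝓡` debt is
printed local mathematics; what remains is the `∃ 𝓡` reciprocity conjecture off the sector (stubs S2a–S2c),
which is not claimed. [cite: BuzzardGeeLMS2014, Conj. 3.2.1 and Conj. 3.2.2]
[cite: HenniartBSMF2002, Thm. 1.5 and Thm. 1.7 (a)] -/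
theorem surfaceSectorComplement_iff_junctionExists_of_namedFacts
    (hF1 : ∀ (F : Type) [Field F] [ValuativeRel F] [TopologicalSpace F] [IsNonarchimedeanLocalField F]
      (hmul : @IsFrobPow.mul F _ _ _ _) (huniq : @IsFrobPow.unique F _ _ _ _)
      (hn : absInertia_normal F) (hex : @exists_isFrobPow F _ _ _ _)
      (hns : @WeilGroup.exists_subgroup_le_inertia_isOpen_of_continuous F _ _ _ _)
      (d : LocalArtinData F) (𝓔 : LocalEpsilonSystem F) (hd : 𝓔.artin F = d),
      localLanglands_gl F hmul huniq hn hex hns d 𝓔 hd)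
    (hF2 : ∀ (F : Type) [Field F] [ValuativeRel F] [TopologicalSpace F] [IsNonarchimedeanLocalField F]
      (hmul : @IsFrobPow.mul F _ _ _ _) (huniq : @IsFrobPow.unique F _ _ _ _)
      (hn : absInertia_normal F) (hex : @exists_isFrobPow F _ _ _ _)
      (hns : @WeilGroup.exists_subgroup_le_inertia_isOpen_of_continuous F _ _ _ _)
      (d : LocalArtinData F) (𝓔 : LocalEpsilonSystem F) (hd : 𝓔.artin F = d),
      localLanglands_gl_indecomposable F hmul huniq hn hex hns d 𝓔 hd)
    (hF3 : ∀ (F : Type) [Field F] [ValuativeRel F] [TopologicalSpace F] [IsNonarchimedeanLocalField F],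
      Henniart2002_isEquivalent_of_rootMultiplicity_eulerFactor_tprod_eq F) :
    SurfaceSectorComplement ↔
      (EndTrivialSurfacesModular →
        ∀ (F : Type) [Field F] [NumberField F], ∃ 𝓡 : ReciprocityData F, ∀ n : ℕ, 0 < n →
          ∀ hcpt : isCompact_glFiniteIntegralLevel n F, GlobalLanglandsCorrespondenceGLn n F 𝓡 hcpt) := by
  refine ⟨fun hC hX F _ _ => ?_, surfaceSectorComplement_of_junctionExists_of_namedFacts hF1 hF2 hF3⟩
  obtain ⟨⟨𝓡⟩, hall⟩ := hC hX F
  exact ⟨𝓡, hall 𝓡⟩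

/-! ## §2 The sandwich by the item `ReciprocityUpToIrreducibilityR` (stmt-Langlands-17925) -/

/-- **SUFFICIENCY — the frame from the texts of items stmt-Langlands-17925, 13622, 19093** (the sector
hypothesis X is discarded: the three texts give the summit itself,
`PhantomRMYoshidaJunctionOfR.langlands_of_reciprocityUpToIrreducibilityR_text_of_JS`).
[cite: BuzzardGeeLMS2014, Conj. 3.2.1 and Conj. 3.2.2] [cite: ArthurClozelAMS120, Ch. 3 §2 (2.2)–(2.3)] -/
theorem surfaceSectorComplement_of_reciprocityUpToIrreducibilityR_text_of_JS
    (h22 : AnalyticDescent.PairLBoundaryJS) (h23 : AnalyticDescent.PairLPoleJS)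
    (hR : ∀ (F : Type) [Field F] [NumberField F], Nonempty (ReciprocityData F) ∧
      ∀ (Rec : ReciprocityData F) (n : ℕ), 0 < n →
        ∀ hcpt : isCompact_glFiniteIntegralLevel n F,
          (∀ π : CuspidalAutomorphicRepData n F hcpt, π.1.IsLAlgebraic →
            ∀ (ℓ : ℕ) [Fact ℓ.Prime] (ι : PadicAlgCl ℓ ≃+* ℂ),
              ∃ ρ : FramedGaloisRep F (PadicAlgCl ℓ) n,
                IsGeometricFramed Rec ρ ∧ Corresponds Rec ι π.1 ρ) ∧ GaloisToAutomorphic n Rec hcpt) :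
    SurfaceSectorComplement :=
  fun _ => PhantomRMYoshidaJunctionOfR.langlands_of_reciprocityUpToIrreducibilityR_text_of_JS h22 h23 hR

/-- **NECESSITY under the route target** — the frame and X give the summit, hence the text of item
stmt-Langlands-17925 (reciprocity up to irreducibility for every pinned datum, with the non-vacuity
conjunct): the frame cannot close before that item once the target holds. [folklore] -/
theorem reciprocityUpToIrreducibilityR_text_of_surfaceSectorComplement (hC : SurfaceSectorComplement)
    (hX : EndTrivialSurfacesModular) :
    ∀ (F : Type) [Field F] [NumberField F], Nonempty (ReciprocityData F) ∧
      ∀ (Rec : ReciprocityData F) (n : ℕ), 0 < n →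
        ∀ hcpt : isCompact_glFiniteIntegralLevel n F,
          (∀ π : CuspidalAutomorphicRepData n F hcpt, π.1.IsLAlgebraic →
            ∀ (ℓ : ℕ) [Fact ℓ.Prime] (ι : PadicAlgCl ℓ ≃+* ℂ),
              ∃ ρ : FramedGaloisRep F (PadicAlgCl ℓ) n,
                IsGeometricFramed Rec ρ ∧ Corresponds Rec ι π.1 ρ) ∧ GaloisToAutomorphic n Rec hcpt :=
  PhantomRMYoshidaJunctionOfR.reciprocityUpToIrreducibilityR_text_of_langlands (hC hX)

/-- **Under the route target X and Arthur–Clozel (2.2)/(2.3), the frame IS the text of item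
stmt-Langlands-17925** (sufficiency + necessity above): an alternative junction for this frame, beside
`X →` item 1093 ∘ item 1094 ∘ item 1095.
[cite: BuzzardGeeLMS2014, Conj. 3.2.1 and Conj. 3.2.2] [cite: ArthurClozelAMS120, Ch. 3 §2 (2.2)–(2.3)] -/
theorem surfaceSectorComplement_iff_reciprocityUpToIrreducibilityR_text
    (h22 : AnalyticDescent.PairLBoundaryJS) (h23 : AnalyticDescent.PairLPoleJS)
    (hX : EndTrivialSurfacesModular) :
    SurfaceSectorComplement ↔
      ∀ (F : Type) [Field F] [NumberField F], Nonempty (ReciprocityData F) ∧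
        ∀ (Rec : ReciprocityData F) (n : ℕ), 0 < n →
          ∀ hcpt : isCompact_glFiniteIntegralLevel n F,
            (∀ π : CuspidalAutomorphicRepData n F hcpt, π.1.IsLAlgebraic →
              ∀ (ℓ : ℕ) [Fact ℓ.Prime] (ι : PadicAlgCl ℓ ≃+* ℂ),
                ∃ ρ : FramedGaloisRep F (PadicAlgCl ℓ) n,
                  IsGeometricFramed Rec ρ ∧ Corresponds Rec ι π.1 ρ) ∧ GaloisToAutomorphic n Rec hcpt :=
  ⟨fun hC => reciprocityUpToIrreducibilityR_text_of_surfaceSectorComplement hC hX,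
    surfaceSectorComplement_of_reciprocityUpToIrreducibilityR_text_of_JS h22 h23⟩

end Summit.Langlands.Langlands.Theorems.ReciprocityRigidity

end
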